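import Literature.AnabelianGeometry.AbsoluteAnabelian.AbsTopIII.ReconstructionCor110iiPrime
import Literature.AnabelianGeometry.AbsoluteAnabelian.GaloisCyclotomeRestriction
import Literature.AnabelianGeometry.AbsoluteAnabelian.GaloisCyclotomeReciprocityFundamental
import Literature.NumberTheory.GaloisRepresentations.LocalReciprocityNormFunctoriality
import Literature.NumberTheory.GaloisRepresentations.AbsGaloisTransfer
import HarnessLib

/-!
# [AbsTopIII] Cor. 1.10 (i)(b), natural form with clause (1) PINNED on THE reciprocity map (statement)

Mochizuki, *Topics in Absolute Anabelian Geometry III*, Cor. 1.10 (i)(b) p. 42 (kurims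
`paper:url-5493eb38cbb7`; statement p. 41: «the natural surjection `H¹(G_k, μ_Ẑ(G_k)) ⥲ G_k^ab ↠ Ẑ` [cf. (b)
below]»; (b) p. 42: «one constructs the surjection `H¹(G_k, μ_Ẑ(G_k)) ⥲ G_k^ab ↠ G_k^unr ⥲ Ẑ`» — the isomorphism
`H¹(G_k, μ_Ẑ(G_k)) ⥲ G_k^ab` typed here is the FIRST ARROW of that display; print's phrase «the natural
isomorphism» belongs to (a), `H²(G_k, μ_Ẑ(G_k)) ⥲ Ẑ`); (ii)(d) p. 42–43 («the image
of the Kummer map `k^× ↪ H¹(G_k, μ_Ẑ(·))`»); [AbsAnab] §1.2 p. 9: «by local class field theory [...], we have a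
natural isomorphism `(K_i^×)^∧ ⥲ G^ab_{K_i}`».

WHY THIS FILE (abc-iut layer L4, abc-iut-L4-d3, twin of `ReconstructionCor110iaNaturalFund.lean` for (b);
L4-lead 13:08:57Z «your own GAP list if any item is ≤ 150 l»).  The tree's (b) Props — abc-iut-L4-d1's
`AbsTopIII.Cor_1_10_i_b_natural` (reading (N)) and the packaged family of
`AbsTopIII.cor_1_10_i_b_resNatural_holds` — state clause (1) as «for SOME `G_k`-equivariant `φ`,
`j_k ∘ H¹(φ)⁻¹ ∘ κ̂ : kˣ → G_k^ab` IS A local reciprocity map (`IsLocalReciprocityMap`, Serre's LIST of printed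
properties)».  Two freedoms hide in that clause: the `Ẑˣ`-torsor of equivariant `φ` (abc-iut-w6-d022,
`GaloisCyclotomeReciprocityZhatTorsor.lean`) and the fact that a property list does not single out THE Artin map.
Print has neither: (b) is THE isomorphism induced by THE reciprocity maps of local class field theory.  This
statements file pins BOTH on the tree's canonical objects:

* `AbsTopIII.Cor_1_10_i_b_natural_fund` — ONE family `j_k : H¹(G_k, μ_Ẑ(G_k)) ≃+ G_k^ab` over the MLFs
  `k : Type` with (1♯) `j_k ∘ H¹(i_k^fund)⁻¹ ∘ κ̂ = θ_k` ON THE NOSE, where `i_k^fund` is THE identification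
  `μ_Ẑ(G_k) ≅ Ẑ(1)(k̄)` of THE fundamental torsion reciprocity datum (`TorsionReciprocityData.fundamental k`,
  abc-iut-w6-d022) and `θ_k` is THE canonical reciprocity map of the tree's local class field theory
  (`(isReciprocitySystemE (isClassFieldTheory_localWeilDatum k)).theta`, Neukirch IV (6.4)–(6.5) / Serre XIII §4,
  the level `E = k` of abc-iut-L4-d3's `isLocalReciprocityMap_levelTheta`); (2) naturality in EVERY isomorphism
  of topological groups `α : G_{k₁} ≃ₜ* G_{k₂}` (`j_{k₂} ∘ H¹(α; μ_Ẑ(α)) = α^{ab} ∘ j_{k₁}`); (3) the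
  restriction/Verlagerung square `j_{k′} ∘ Res = Ver_{k′/k} ∘ j_k` along every finite `k′/k`
  ([AbsAnab] p. 11 «by considering the Verlagerung»).

(1♯) pins `j_k` on the Kummer image of `kˣ` (a DENSE copy of `kˣ` in `H¹(G_k, μ_Ẑ(G_k)) ≅ (kˣ)^∧`); the
closer is the proof-only companion `ReconstructionCor110ibNaturalFundProofs.lean`
(`cor_1_10_i_b_natural_fund_holds`, THE family of `Cor110Nat.exists_family_components` whose data ARE
`fundamental k` and whose completed reciprocity isomorphisms extend `θ_k`), which also derives the ∃φ forms.
Statement only (`Prop`; no data definition; not closable by choice).  HONEST FRAMING: refereed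
[AbsTopIII]/[AbsAnab]; classical local class field theory and Kummer theory; nothing here bears on [IUTchIII]
Cor. 3.12 or takes a side; typed ≠ proved.
-/

noncomputable section

open CategoryTheory Function
open Field ValuativeRel
open ProfiniteGrp ProfiniteGrp.ProfiniteCompletion

namespace Literature.AnabelianGeometry.AbsoluteAnabelian

open _root_.TopRep _root_.ContRepresentation _root_.ContinuousCohomology
open Literature.NumberTheory.GaloisRepresentations
open Literature.NumberTheory.GaloisRepresentations.LocalWeilDatum

namespace AbsTopIII

/-- **[AbsTopIII] Cor. 1.10 (i)(b), clause (1) PINNED on THE reciprocity map.**  There is ONE family of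
additive isomorphisms `j_k : H¹(G_k, μ_Ẑ(G_k)) ≃+ G_k^ab`, indexed by the MLFs `k : Type` (valued form), such that
(1♯) for every `u ∈ kˣ`: `j_k (H¹(i_k^fund)⁻¹ (κ̂ u)) = θ_k(u)` — the composite
`kˣ —κ̂→ H¹(G_k, Ẑ(1)) —H¹(i_k^fund)⁻¹→ H¹(G_k, μ_Ẑ(G_k)) —j_k→ G_k^ab` (`reciprocityOfContainerIso`) through THE
fundamental identification `i_k^fund = galCyclotomeIsoTateModule k (fundamental k).equiv _` IS THE canonical
reciprocity map `θ_k = (isReciprocitySystemE (isClassFieldTheory_localWeilDatum k)).theta` of local class field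
theory (arithmetic normalisation: uniformisers ↦ Frobenius);
(2) for EVERY isomorphism of topological groups `α : G_{k₁} ≃ₜ* G_{k₂}`:
`j_{k₂} (H¹(α; μ_Ẑ(α)) x) = α^{ab} (j_{k₁} x)`;
(3) for every finite extension `k′/k`: `j_{k′} (Res x) = Ver_{k′/k} (j_k x)` (`Res = galCyclotomeRes k k′ 1`,
`Ver = verlagerung k k′`).  Universe `0`.  (The instance binder `[ValuativeExtension k k]` in (1♯) is the
reflexive one `⟨fun _ _ => Iff.rfl⟩`; it is how the tree's level-`E = k` reciprocity map is spelled.)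
[cite: MochizukiAbsTopIII2015, Cor 1.10 (i) p.42] [cite: MochizukiAbsAnab2004, Prop 1.2.1 (vi) p.10] -/
def Cor_1_10_i_b_natural_fund : Prop :=
  ∃ j : ∀ (k : Type) [Field k] [ValuativeRel k] [TopologicalSpace k] [IsNonarchimedeanLocalField k]
      [CharZero k],
      galCyclotomeH1 (absoluteGaloisGroup k) ≃+ Additive (absoluteGaloisGroupAbelianization k),
    (∀ (k : Type) [Field k] [ValuativeRel k] [TopologicalSpace k] [IsNonarchimedeanLocalField k]
      [CharZero k] [ValuativeExtension k k] (u : kˣ),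
      reciprocityOfContainerIso (TorsionReciprocityData.fundamental k).equiv_smul (j k) u =
        (isReciprocitySystemE (F := k) (E := k) (isClassFieldTheory_localWeilDatum k)).theta u) ∧
    (∀ (k₁ : Type) [Field k₁] [ValuativeRel k₁] [TopologicalSpace k₁] [IsNonarchimedeanLocalField k₁]
      [CharZero k₁]
      (k₂ : Type) [Field k₂] [ValuativeRel k₂] [TopologicalSpace k₂] [IsNonarchimedeanLocalField k₂]
      [CharZero k₂]
      (α : absoluteGaloisGroup k₁ ≃ₜ* absoluteGaloisGroup k₂) (x : galCyclotomeH1 (absoluteGaloisGroup k₁)),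
      j k₂ (galCyclotomeH1Map α x) = Additive.ofMul (abelianizationCongr α (Additive.toMul (j k₁ x)))) ∧
    ∀ (k : Type) [Field k] [ValuativeRel k] [TopologicalSpace k] [IsNonarchimedeanLocalField k] [CharZero k]
      (k' : Type) [Field k'] [ValuativeRel k'] [TopologicalSpace k'] [IsNonarchimedeanLocalField k'] [CharZero k']
      [Algebra k k'] [FiniteDimensional k k'] (x : galCyclotomeH1 (absoluteGaloisGroup k)),
      j k' ((galCyclotomeRes k k' 1).hom x) =
        Additive.ofMul (Literature.NumberTheory.GaloisRepresentations.verlagerung k k' (Additive.toMul (j k x)))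

end AbsTopIII

end Literature.AnabelianGeometry.AbsoluteAnabelian
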